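import Summits.CriticalPhenomena.SAWScalingLimit.Theorems.SAWDevelopingMapObservableToSLETypeLadderCarvedReductionSqueezeGateHalfBall
import HarnessLib

/-!
# Locality bounds in the pinned frame: Hausdorff limits of removed-core sets stay within `R` of the
# pinned root (piece (T-A′ bounds) of stub T-A′ `stub_carvedReduction_squeezeGeometry_domains`)

Crux `SAWDevelopingMap.ObservableToSLE` (stmt-CriticalPhenomena-10472), line `six-class-type-ladder`,
stub T-A′ `stub_carvedReduction_squeezeGeometry_domains`.  Landing target:
`Summits/CriticalPhenomena/SAWScalingLimit/Theorems/SAWDevelopingMapObservableToSLETypeLadderCarvedReductionSqueezeGateBounds.lean`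
(`--supports stmt-CriticalPhenomena-10472`; registered carrier `stub_carvedReduction_gateBounds`).

The limit package (`squeeze_limitPackage`, p141874) records the limit bodies and spines only inside
`closedBall (root) (R + 1)`; the separation of the two gates' corridors (worker log, item B) needs
the sharp locality `B ⊆ closedBall α R`, `α = D.pt i - τ` the pinned root.  It follows from the
per-level facts the package also records: the `m`-neighbourhood (`m = ρ/4`, `ρ/8`) of the level-`j`
set `Bp j` consists of pinned centres of REMOVED vertices, removed vertices lie within `R` of the
rescaled root (`TameNestedFamily`), the pinned roots converge to `α`, and `Bp j → B` in Hausdorff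
distance; the lattice is `2 s_j`-dense (`exists_upFace_near`).

* `subset_closedBall_of_hausdorff_limit` (= registered `stub_carvedReduction_gateBounds`) — the
  bound `B ⊆ closedBall α R`;
* `dist_le_of_adj_mem` — a vertex adjacent to a removed vertex is within `R + s` of the rescaled
  root (the realised gate `q_j`, adjacent to `p_j ∈ S_j(n_j)`; in the limit `|P_i + τ - D.pt i| ≤ R`).
-/

noncomputable section

open scoped Topology
open Filter Set Metric Bornology
open Literature.Probability.LatticeModels (HexVertex hexGraph hexCenter triEmbed Site)
open Literature.Probability.RandomPlanarGeometry

namespace Summit.CriticalPhenomena.SAWScalingLimit.Theorems.ObservableToSLE.TypeLadder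

open Summit.CriticalPhenomena.SAWScalingLimit.Theorems.ObservableToSLER.TwoPiece (dist_smul_hexCenter_le_of_adj)

/-- Pinning (subtracting the same translation) preserves distances between rescaled centres. -/
theorem dist_pinned_eq (t : ℂ) (u v : ℂ) : dist (u - t) (v - t) = dist u v := by
  rw [dist_eq_norm, dist_eq_norm]; congr 1; ring_nf

/-- **The lattice is `2s`-dense at every mesh `s > 0`**: every point is within `2 s` of a rescaled
up-face centre. -/
theorem exists_vertex_near (z : ℂ) {t : ℝ} (ht : 0 < t) :
    ∃ v : HexVertex, dist ((t : ℂ) * hexCenter v) z ≤ 2 * t := by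
  obtain ⟨g, hg1, hg2, hg3, -⟩ := exists_upFace_near z
  refine ⟨(g t, 0), (dist_le_abs_re_add_abs_im _ _).trans ?_⟩
  rw [Complex.sub_re, Complex.sub_im]
  have h1 := hg1 t ht
  have h2 := hg2 t ht
  have h3 := hg3 t ht
  have e2 : |((t : ℂ) * hexCenter ((g t, 0) : HexVertex)).im - z.im| ≤ t := by
    rw [abs_le]; constructor <;> linarith
  linarith

/-- **A vertex adjacent to a removed vertex is within `R + s` of the rescaled root.** -/
theorem dist_le_of_adj_mem {t R : ℝ} (ht : 0 ≤ t) {S : Set HexVertex} {c p q : HexVertex}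
    (hS : ∀ v ∈ S, dist ((t : ℂ) * hexCenter v) ((t : ℂ) * hexCenter c) ≤ R) (hp : p ∈ S) (hpq : hexGraph.Adj p q) :
    dist ((t : ℂ) * hexCenter q) ((t : ℂ) * hexCenter c) ≤ R + t :=
  calc dist ((t : ℂ) * hexCenter q) ((t : ℂ) * hexCenter c)
      ≤ dist ((t : ℂ) * hexCenter q) ((t : ℂ) * hexCenter p) + dist ((t : ℂ) * hexCenter p) ((t : ℂ) * hexCenter c) :=
        dist_triangle _ _ _
    _ ≤ t + R := add_le_add (by rw [dist_comm]; exact dist_smul_hexCenter_le_of_adj ht hpq) (hS p hp)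
    _ = R + t := add_comm _ _

/-- **Registered carrier `stub_carvedReduction_gateBounds`** (crux item stmt-CriticalPhenomena-10472,
stub T-A′ `stub_carvedReduction_squeezeGeometry_domains`, piece LOCALITY OF THE LIMIT SETS): if the
`m`-neighbourhood (`m > 0`) of `Bp j` in the pinned frame consists of pinned centres of vertices of
`S j`, the vertices of `S j` are within `R` of the rescaled root `c j`, the pinned roots converge
to `α`, and `Bp j → B` in Hausdorff distance (all sets nonempty and bounded), then
`B ⊆ closedBall α R`. -/
theorem stub_carvedReduction_gateBounds :
    ∀ (s : ℕ → ℝ) (x : ℕ → Site 2) (S : ℕ → Set HexVertex) (c : ℕ → HexVertex) (Bp : ℕ → Set ℂ) (B : Set ℂ)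
      (α : ℂ) (R m : ℝ), (∀ j, 0 < s j) → Tendsto s atTop (𝓝 0) → 0 < m →
      (∀ j (v : HexVertex), infDist ((s j : ℂ) * hexCenter v - (s j : ℂ) * triEmbed (x j)) (Bp j) ≤ m → v ∈ S j) →
      (∀ j, ∀ v ∈ S j, dist ((s j : ℂ) * hexCenter v) ((s j : ℂ) * hexCenter (c j)) ≤ R) →
      Tendsto (fun j => (s j : ℂ) * hexCenter (c j) - (s j : ℂ) * triEmbed (x j)) atTop (𝓝 α) →
      Tendsto (fun j => hausdorffDist (Bp j) B) atTop (𝓝 0) → (∀ j, (Bp j).Nonempty) → (∀ j, IsBounded (Bp j)) →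
      B.Nonempty → IsBounded B → B ⊆ closedBall α R := by
  intro s x S c Bp B α R m hs hs0 hm hBp hSR hroot hH hBpne hBpbd hBne hBbd b hb
  rw [mem_closedBall]
  refine le_of_forall_pos_lt_add fun ε hε => ?_
  -- eventually: Hausdorff distance, mesh and root error are all `< ε/4`, and `2 s_j ≤ m`
  have h1 : ∀ᶠ j in atTop, hausdorffDist (Bp j) B < ε / 4 := hH.eventually (gt_mem_nhds (by positivity))
  have h2 : ∀ᶠ j in atTop, 2 * s j < min (ε / 4) m := by
    have : Tendsto (fun j => 2 * s j) atTop (𝓝 (2 * 0)) := hs0.const_mul 2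
    rw [mul_zero] at this
    exact this.eventually (gt_mem_nhds (lt_min (by positivity) hm))
  have h3 : ∀ᶠ j in atTop, dist ((s j : ℂ) * hexCenter (c j) - (s j : ℂ) * triEmbed (x j)) α < ε / 4 :=
    (tendsto_iff_dist_tendsto_zero.1 hroot).eventually (gt_mem_nhds (by positivity))
  obtain ⟨j, hj1, hj2, hj3⟩ := (h1.and (h2.and h3)).exists
  have hj2' : 2 * s j < ε / 4 := hj2.trans_le (min_le_left _ _)
  have hj2m : 2 * s j ≤ m := (hj2.trans_le (min_le_right _ _)).le
  -- a point of `Bp j` close to `b`, a vertex close to it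
  have hfin : Metric.hausdorffEDist B (Bp j) ≠ ⊤ :=
    hausdorffEDist_ne_top_of_nonempty_of_bounded hBne (hBpne j) hBbd (hBpbd j)
  obtain ⟨b', hb', hbb'⟩ := exists_dist_lt_of_hausdorffDist_lt hb (by rwa [hausdorffDist_comm]) hfin
  set τj : ℂ := (s j : ℂ) * triEmbed (x j) with hτj
  obtain ⟨v, hv⟩ := exists_vertex_near (b' + τj) (hs j)
  have hvb' : dist ((s j : ℂ) * hexCenter v - τj) b' ≤ 2 * s j := by
    rwa [← dist_pinned_eq τj ((s j : ℂ) * hexCenter v) (b' + τj), add_sub_cancel_right] at hv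
  have hvS : v ∈ S j := hBp j v ((infDist_le_dist_of_mem hb').trans (hvb'.trans hj2m))
  have hvc : dist ((s j : ℂ) * hexCenter v - τj) ((s j : ℂ) * hexCenter (c j) - τj) ≤ R := by
    rw [dist_pinned_eq τj]; exact hSR j v hvS
  have hvb'' : dist b' ((s j : ℂ) * hexCenter v - τj) ≤ 2 * s j := by rwa [dist_comm] at hvb'
  have htri : dist b α ≤ dist b b' + dist b' ((s j : ℂ) * hexCenter v - τj) +
      dist ((s j : ℂ) * hexCenter v - τj) ((s j : ℂ) * hexCenter (c j) - τj) +
      dist ((s j : ℂ) * hexCenter (c j) - τj) α := by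
    have h1 := dist_triangle b b' α
    have h2 := dist_triangle b' ((s j : ℂ) * hexCenter v - τj) α
    have h3 := dist_triangle ((s j : ℂ) * hexCenter v - τj) ((s j : ℂ) * hexCenter (c j) - τj) α
    linarith
  linarith [hbb'.le]

end Summit.CriticalPhenomena.SAWScalingLimit.Theorems.ObservableToSLE.TypeLadder

end
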